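import Mathlib
import Summits.Ventures.HodgeRepro.Tier4.Line1.RTFSetting

/-!
# Tier4/Line1/IsotypicIdempotent — the σ-ISOTYPIC IDEMPOTENT `eσ = dim σ · μ(K)⁻¹ · 1_K · conj χ_σ` on a compact open `K`
and its three identities, DISCHARGED in the kernel (plan-1's cut (S3σ) S14082; consumer p5's `HeckeBlockW.ofIdempotent` S14087)

Blind re-derivation cell `pub-hodge-repro`, Tier 4 (README §9–§10), seat t4-L1-p3 (prover, LINE L1, gen 3).  Target tree
path `lean/Summits/Ventures/HodgeRepro/Tier4/Line1/IsotypicIdempotent.lean`.  Imports ONLY `RTFSetting` (`S.μ`, `IsTest`,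
`refl`, `cj`, `conv`).  Paper proof: proofs/t4/L1/S3sigma-isotypic-idempotent-t4-L1-p3.md.  0 printed inputs.

WHAT THIS IS.  The type-σ twin of p5's level average `indK` (HeckeBlockSpherical p686211): for a compact OPEN subgroup
`K ≤ G` and a continuous unitary irreducible representation `ρ : K →* Matrix (Fin d) (Fin d) ℂ` OF `K` ITSELF (on the
instance `K = K_f(N) × U(W)(k_∞)` on a totally definite plane and `ρ = σ ∘ (archimedean projection)` — that extension is
the instance's bridge, not typed here), `eσ g := (d · (μ K).toReal⁻¹) · conj (trace (repExt g))` (`repExt` = `ρ` extended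
by `0` off `K`) is a test function (`isTest_eσ`), symmetric (`cj_refl_eσ : cj (refl eσ) = eσ`) and IDEMPOTENT for the
setting's convolution (`conv_eσ_eσ : S.conv eσ eσ = eσ`) — the last is SCHUR ORTHOGONALITY for the one irreducible `σ`,
proved from Mathlib's `Module.End.exists_eigenvalue` (`schurMatrix` commutes with `ρ` ⇒ scalar; its trace fixes the
scalar): `schur_orthogonality`, character form `charExt_conv`.  All integrals are against the SAME `S.μ` as `R_R_indK`;
the volume constant is explicit; `d = 1, ρ = 1` gives `indK` verbatim.  Unitarity / irreducibility are DISPLAYED data.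
NOT claimed: finite-dimensionality of the fixed space of `R(eσ)` (p1's `levelBlock`), the `H`-module structure of a
block, (C1), (C2), anything about the instance's corner forms, or `P_T4`.  Nothing here says anything about the status of
the Hodge conjecture for CM abelian varieties, which is NOT proved (HC_CM is NOT proved by anyone in this repository).
-/

set_option autoImplicit false

noncomputable section

namespace Summit.Ventures.HodgeRepro.Tier4.Line1

open MeasureTheory Topology Set Matrix

namespace RTF.Setting

variable {G : Type} [Group G] [TopologicalSpace G] [IsTopologicalGroup G] [MeasurableSpace G] [BorelSpace G]
  (S : Setting G) (K : Subgroup G) {d : ℕ} (ρ : K →* Matrix (Fin d) (Fin d) ℂ)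

section Data

variable {K} in
/-- **unitary**: `ρ(k)ᴴ ρ(k) = 1` for every `k ∈ K` (DATA). -/
structure IsUnitaryRep : Prop where
  unitary : ∀ k : K, (ρ k)ᴴ * ρ k = 1

variable {K} in
/-- **irreducible**: every subspace of `ℂ^d` stable under all `ρ k ·ᵥ ·` is `⊥` or `⊤` (DATA, never derived). -/
structure IsIrreducibleRep : Prop where
  irred : ∀ U : Submodule ℂ (Fin d → ℂ), (∀ k : K, ∀ v ∈ U, (ρ k).mulVec v ∈ U) → U = ⊥ ∨ U = ⊤

omit [TopologicalSpace G] [IsTopologicalGroup G] [MeasurableSpace G] [BorelSpace G] in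
open Classical in
/-- `ρ` extended by zero off `K`, as a matrix-valued function on `G`. -/
def repExt (g : G) : Matrix (Fin d) (Fin d) ℂ := if h : g ∈ K then ρ ⟨g, h⟩ else 0

omit [TopologicalSpace G] [IsTopologicalGroup G] [MeasurableSpace G] [BorelSpace G] in
/-- the character `χ_σ = trace ∘ ρ`, extended by zero off `K`. -/
def charExt (g : G) : ℂ := Matrix.trace (repExt K ρ g)

/-- **THE σ-ISOTYPIC IDEMPOTENT** `eσ g = (d · μ(K)⁻¹) · conj χ_σ(g)` on `K`, `0` off `K` (for `d = 1`, `ρ = 1` this is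
p5's `indK S K`).  The volume is the setting's own `S.μ K`. -/
def eσ (g : G) : ℂ := ((d : ℂ) * ((((S.μ (K : Set G)).toReal)⁻¹ : ℝ) : ℂ)) * starRingEnd ℂ (charExt K ρ g)

end Data

section Extension

omit [TopologicalSpace G] [IsTopologicalGroup G] [MeasurableSpace G] [BorelSpace G] in
/-- on `K`, `repExt` is `ρ`. -/
theorem repExt_of_mem {g : G} (hg : g ∈ K) : repExt K ρ g = ρ ⟨g, hg⟩ := dif_pos hg

omit [TopologicalSpace G] [IsTopologicalGroup G] [MeasurableSpace G] [BorelSpace G] in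
/-- off `K`, `repExt` is `0`. -/
theorem repExt_of_not_mem {g : G} (hg : g ∉ K) : repExt K ρ g = 0 := dif_neg hg

omit [TopologicalSpace G] [IsTopologicalGroup G] [MeasurableSpace G] [BorelSpace G] in
/-- `repExt` restricted to `K` is `ρ`. -/
theorem repExt_coe (k : K) : repExt K ρ (k : G) = ρ k := by
  rw [repExt_of_mem K ρ k.2]

omit [TopologicalSpace G] [IsTopologicalGroup G] [MeasurableSpace G] [BorelSpace G] in
/-- (E1) multiplicative on `K`. -/
theorem repExt_mul {g g' : G} (hg : g ∈ K) (hg' : g' ∈ K) :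
    repExt K ρ (g * g') = repExt K ρ g * repExt K ρ g' := by
  rw [repExt_of_mem K ρ (K.mul_mem hg hg'), repExt_of_mem K ρ hg, repExt_of_mem K ρ hg']
  exact map_mul ρ ⟨g, hg⟩ ⟨g', hg'⟩

omit [TopologicalSpace G] [IsTopologicalGroup G] [MeasurableSpace G] [BorelSpace G] in
/-- (E2) `repExt 1 = 1`. -/
theorem repExt_one : repExt K ρ 1 = 1 := by
  rw [repExt_of_mem K ρ K.one_mem]
  exact map_one ρ

omit [TopologicalSpace G] [IsTopologicalGroup G] [MeasurableSpace G] [BorelSpace G] in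
/-- `K` is closed under inverses, contrapositively. -/
theorem not_mem_inv {g : G} (hg : g ∉ K) : g⁻¹ ∉ K := fun h => hg (by simpa using K.inv_mem h)

omit [TopologicalSpace G] [IsTopologicalGroup G] [MeasurableSpace G] [BorelSpace G] in
/-- (E3) for a unitary `ρ` and `g ∈ K`: `repExt g⁻¹ = (repExt g)ᴴ` (a one-sided inverse of a square matrix is two-sided). -/
theorem repExt_inv (hu : IsUnitaryRep ρ) {g : G} (hg : g ∈ K) : repExt K ρ g⁻¹ = (repExt K ρ g)ᴴ := by
  have h1 : repExt K ρ g⁻¹ * repExt K ρ g = 1 := by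
    rw [← repExt_mul K ρ (K.inv_mem hg) hg, inv_mul_cancel, repExt_one]
  have h2 : (repExt K ρ g)ᴴ * repExt K ρ g = 1 := by
    rw [repExt_of_mem K ρ hg]
    exact hu.unitary ⟨g, hg⟩
  have h3 : repExt K ρ g * repExt K ρ g⁻¹ = 1 := mul_eq_one_comm.mp h1
  calc repExt K ρ g⁻¹ = 1 * repExt K ρ g⁻¹ := (Matrix.one_mul _).symm
    _ = ((repExt K ρ g)ᴴ * repExt K ρ g) * repExt K ρ g⁻¹ := by rw [h2]
    _ = (repExt K ρ g)ᴴ * (repExt K ρ g * repExt K ρ g⁻¹) := by rw [Matrix.mul_assoc]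
    _ = (repExt K ρ g)ᴴ := by rw [h3, Matrix.mul_one]

omit [TopologicalSpace G] [IsTopologicalGroup G] [MeasurableSpace G] [BorelSpace G] in
/-- (E4) `χ_σ(g⁻¹) = conj χ_σ(g)`, everywhere on `G`. -/
theorem charExt_inv (hu : IsUnitaryRep ρ) (g : G) : charExt K ρ g⁻¹ = starRingEnd ℂ (charExt K ρ g) := by
  by_cases hg : g ∈ K
  · unfold charExt
    rw [repExt_inv K ρ hu hg, Matrix.trace_conjTranspose]
    rfl
  · unfold charExt
    rw [repExt_of_not_mem K ρ hg, repExt_of_not_mem K ρ (not_mem_inv K hg), Matrix.trace_zero, map_zero]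

omit [TopologicalSpace G] [IsTopologicalGroup G] [MeasurableSpace G] [BorelSpace G] in
/-- off `K`, `χ_σ` is `0`. -/
theorem charExt_of_not_mem {g : G} (hg : g ∉ K) : charExt K ρ g = 0 := by
  unfold charExt
  rw [repExt_of_not_mem K ρ hg, Matrix.trace_zero]

omit [IsTopologicalGroup G] [BorelSpace G] in
/-- off `K`, `eσ` is `0`. -/
theorem eσ_of_not_mem {g : G} (hg : g ∉ K) : eσ S K ρ g = 0 := by
  unfold eσ
  rw [charExt_of_not_mem K ρ hg, map_zero, mul_zero]

end Extension

section Continuity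

omit [MeasurableSpace G] [BorelSpace G] in
/-- (E5) the extension by zero is continuous on `G` (`K` is clopen). -/
theorem continuous_repExt (hKo : IsOpen (K : Set G)) (hρ : Continuous ρ) : Continuous (repExt K ρ) := by
  have h1 : ContinuousOn (repExt K ρ) (K : Set G) := by
    rw [continuousOn_iff_continuous_restrict]
    have : (K : Set G).restrict (repExt K ρ) = ρ := by
      funext x
      simp only [Set.restrict_apply]
      exact dif_pos (show (x : G) ∈ K from x.2)
    rw [this]
    exact hρ
  have h2 : ContinuousOn (repExt K ρ) ((K : Set G)ᶜ) := by
    have : EqOn (repExt K ρ) (fun _ => (0 : Matrix (Fin d) (Fin d) ℂ)) ((K : Set G)ᶜ) :=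
      fun x hx => repExt_of_not_mem K ρ hx
    exact continuousOn_const.congr this
  have h3 := h1.union_of_isOpen h2 hKo (K.isClosed_of_isOpen hKo).isOpen_compl
  rw [Set.union_compl_self] at h3
  exact continuousOn_univ.mp h3

omit [MeasurableSpace G] [BorelSpace G] in
/-- `χ_σ` (extended by zero) is continuous on `G`. -/
theorem continuous_charExt (hKo : IsOpen (K : Set G)) (hρ : Continuous ρ) : Continuous (charExt K ρ) :=
  (continuous_repExt K ρ hKo hρ).matrix_trace

omit [BorelSpace G] in
/-- `eσ` is continuous on `G`. -/
theorem continuous_eσ (hKo : IsOpen (K : Set G)) (hρ : Continuous ρ) : Continuous (eσ S K ρ) :=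
  continuous_const.mul (continuous_star.comp (continuous_charExt K ρ hKo hρ))

omit [BorelSpace G] in
/-- (E6) **`eσ` is a test function** (continuous, support inside the compact `K`). -/
theorem isTest_eσ (hKo : IsOpen (K : Set G)) (hKc : IsCompact (K : Set G)) (hρ : Continuous ρ) :
    IsTest (eσ S K ρ) :=
  ⟨continuous_eσ S K ρ hKo hρ,
    HasCompactSupport.intro' hKc (K.isClosed_of_isOpen hKo) fun _ hg => eσ_of_not_mem S K ρ hg⟩

omit [IsTopologicalGroup G] [BorelSpace G] in
/-- (E7) **`eσ` is symmetric**: `cj (refl eσ) = eσ` (from `χ_σ(g⁻¹) = conj χ_σ(g)`). -/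
theorem cj_refl_eσ (hu : IsUnitaryRep ρ) : cj (refl (eσ S K ρ)) = eσ S K ρ := by
  funext g
  simp only [cj, refl, eσ, charExt_inv K ρ hu g, map_mul, Complex.conj_conj, map_natCast, Complex.conj_ofReal]

end Continuity

section Volume

variable (hKo : IsOpen (K : Set G)) (hKc : IsCompact (K : Set G))

omit [IsTopologicalGroup G] [BorelSpace G] in
include hKo hKc in
/-- `0 < μ(K) < ∞` for a compact open `K`: its real volume is non-zero. -/
theorem measure_toReal_ne_zero : (S.μ (K : Set G)).toReal ≠ 0 := by
  haveI := S.haar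
  intro h
  rcases (ENNReal.toReal_eq_zero_iff _).mp h with h0 | htop
  · exact hKo.measure_ne_zero S.μ ⟨1, K.one_mem⟩ h0
  · exact hKc.measure_lt_top.ne htop

end Volume




end RTF.Setting

end Summit.Ventures.HodgeRepro.Tier4.Line1
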